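import Summits.Parity.GeneralizedHardyLittlewood.Theorems.PrimeLevelFamEdgeMomentsBeyondDiagonalDiagDecorBilinearTwoScale
import Summits.Parity.GeneralizedHardyLittlewood.Theorems.PrimeLevelFamEdgeMomentsBeyondDiagonalDiagDecorProfileCoord
import HarnessLib

/-!
# Route `PrimeLevelFamEdge`, crux K_A `MomentsBeyondDiagonal` (stmt-Parity-20007), line «petersson_layers» v4, stub `stub_diag`:
# **the four decorated profile coordinates in MASTER FORMAT (`τ ↦ (P″,2)`, `τ_{1,0} ↦ (−P′,1)`, `τ_{1,1} ↦ (P,0)`,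
# `τ_{2,0} ↦ (0,0)`) and the first evaluated monomial of the order-`(1,1)` target:
# `Σ_{c,g}μ(g)c·Σ y′y′·τ_{1,1}(k₁)τ_{1,1}(k₂) = ζ(2)²·(∫₀¹P²)·log M + O(1)`**

Census R3(ii), ANALYTIC HALF — turnkey inputs for the product-monomial master step
`…DiagDecorBilinearTwoScale.abs_selbergMonomial_two_scale_sub_le`. The hypothesis of the master step is, for a decoration
`t : ℕ → ℝ`, a polynomial `R` and a shift `s`:
`|Σ_c P_c(Σ_{k≤M/n} W(k)[(k,n)=1]·t(k)·logᶜ((M/n)/k))/logᶜM − E_n R(u_n)/log^sM| ≤ C·D(n)((1+κ(n))/log^{s+1}M + 1/((1+log(M/n))²log^sM))`.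
This file puts the four available coordinates in exactly this format:

* `masterInput_tau` — `t = τ` (`k ↦ #k.divisors`), `R = P″`, `s = 2` (`…DiagProfileCoord.abs_profileCoord_sub_derivative2_le`;
  `copTauW n k = W(k)[(k,n)=1]·τ(k)`);
* `masterInput_tau10` — `t = τ_{1,0} = Σ_{d∣k}log d`, `R = −P′`, `s = 1` (`…DiagDecorProfileCoord.abs_decorProfile_tau10_add_le`);
* `masterInput_tau11` — `t = τ_{1,1} = Σ_{d∣k}log d·log(k/d)`, `R = P`, `s = 0` (`…abs_decorProfile_tau11_sub_le`);
* `masterInput_tau20` — `t = τ_{2,0} = Σ_{d∣k}log²d`, `R = 0`, `s = 0` (`…abs_decorProfile_tau20_le`);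
* `abs_selbergMonomial_tau11_tau11_sub_le` — **the `τ_{1,1}(k₁)τ_{1,1}(k₂)` monomial of the order-`(1,1)` weight:
  `|Σ_{c≤⌊M⌋}Σ_{g≤⌊M⌋/c}μ(g)c Σ_{k₁,k₂≤⌊M⌋/(cg)} y′(cgk₁)y′(cgk₂)τ_{1,1}(k₁)τ_{1,1}(k₂) − (π²/6)²(∫₀¹P²)·log M| ≤ C`** (`M ≥ 3`,
  `P₀ = P₁ = 0`) — the first fully evaluated decorated monomial (main term of size `log M = Δ′ℓ`, as the degree count
  `2+2−3 = 1` predicts).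

Any pair of the four decorations is now one application of the master step. Def-free; theorems only. Helper
`--supports stmt-Parity-20007`; closes nothing; K_A, K_B and the Parity summit are NOT proved; nothing about Landau–Siegel zeros.

## References
* E. Kowalski, P. Michel, J. VanderKam, J. reine angew. Math. 526 (2000), (23)–(28) pp. 13–15 and Prop. 5.1 p. 18.
  [cite: KowalskiMichelVanderKam2000, (23)–(28) — derivation (monomials of the diagonal main term in real variables)]
-/

noncomputable section

open scoped Real ArithmeticFunction.Moebius
open Finset ArithmeticFunction Polynomial MeasureTheory intervalIntegral

namespace Summit.Parity.GeneralizedHardyLittlewood.Theorems.MomentsBeyondDiagonal.DiagKernel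

open Literature.NumberTheory.LFunctions Literature.NumberTheory.LFunctions.KMV2000
open MollifierMainTerm (W)
open SelbergCoord (kappa)
open Literature.NumberTheory.Sieve (one_le_log_of_three_le)
open Summit.Parity.GeneralizedHardyLittlewood.Theorems.BeyondDiagonalBeatsQuarter.KernelFormXSq
  (copTauW copTauW_apply mainConst divWeight divWeight_nonneg mainConst_nonneg)

/-- `κ(n) ≥ 0` (local copy of the routine fact). [folklore] -/
private theorem kappa_nonneg_aux (n : ℕ) : 0 ≤ kappa n := by
  unfold kappa
  exact Finset.sum_nonneg fun p hp ↦ by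
    have hp2 : (2 : ℝ) ≤ p := by exact_mod_cast (Nat.prime_of_mem_primeFactors hp).two_le
    exact div_nonneg (Real.log_nonneg (by linarith)) (by linarith)

/-- From the one-scale format `C·D(1+κ)/log^{s+1}M` to the two-scale master format. [folklore] -/
theorem oneScale_le_twoScale {C D Y ℓ : ℝ} (κ : ℝ) (hC : 0 ≤ C) (hD : 0 ≤ D) (hY : 0 ≤ Y) (hℓ : 0 < ℓ) (s : ℕ) :
    C * D * (1 + κ) / ℓ ^ (s + 1) ≤ C * D * ((1 + κ) / ℓ ^ (s + 1) + 1 / ((1 + Y) ^ 2 * ℓ ^ s)) := by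
  have h1 : C * D * (1 + κ) / ℓ ^ (s + 1) = C * D * ((1 + κ) / ℓ ^ (s + 1)) := by ring
  have h2 : 0 ≤ C * D * (1 / ((1 + Y) ^ 2 * ℓ ^ s)) := by positivity
  rw [h1, mul_add]
  linarith

/-! ### The four inputs in master format -/

/-- **Master input `t = τ`**: `R = P″`, `s = 2`, two-scale error (the undecorated profile coordinate).
[cite: KowalskiMichelVanderKam2000, Prop. 5.1 — derivation] -/
theorem masterInput_tau (P : ℝ[X]) (hP0 : P.coeff 0 = 0) (hP1 : P.coeff 1 = 0) :
    ∃ C : ℝ, 0 ≤ C ∧ ∀ M : ℝ, 3 ≤ M → ∀ n : ℕ, n ≠ 0 → (n : ℝ) ≤ M →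
      |∑ c ∈ Finset.range (P.natDegree + 1), P.coeff c *
          ((∑ k ∈ Icc 1 ⌊M / n⌋₊, (if k.Coprime n then W k else 0) * (k.divisors.card : ℝ) *
            Real.log (M / n / k) ^ c) / Real.log M ^ c) -
        mainConst n * (derivative (derivative P)).eval (Real.log (M / n) / Real.log M) / Real.log M ^ 2| ≤
        C * divWeight n * ((1 + kappa n) / Real.log M ^ (2 + 1) +
          1 / ((1 + Real.log (M / n)) ^ 2 * Real.log M ^ 2)) := by
  obtain ⟨C, hC, h⟩ := abs_profileCoord_sub_derivative2_le P hP0 hP1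
  refine ⟨C, hC.le, fun M hM n hn hnM ↦ ?_⟩
  have h' := h M hM n hn hnM
  have hℓ1 : 1 ≤ Real.log M := one_le_log_of_three_le hM
  have hℓ0 : 0 < Real.log M := by linarith
  have hD := divWeight_nonneg n
  have hκ := kappa_nonneg_aux n
  obtain ⟨hY0, -⟩ := log_div_nonneg_and_le hM hn hnM
  have hcop : ∀ k : ℕ, (if k.Coprime n then W k else 0) * (k.divisors.card : ℝ) = copTauW n k := by
    intro k
    rw [copTauW_apply]
    split_ifs <;> ring
  simp only [hcop]
  have hmain : mainConst n * (derivative (derivative P)).eval (Real.log (M / n) / Real.log M) / Real.log M ^ 2 =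
      mainConst n * ((derivative (derivative P)).eval (Real.log (M / n) / Real.log M) / Real.log M ^ 2) := by ring
  rw [hmain]
  refine h'.trans ?_
  rw [mul_add]
  have h1 : C * divWeight n * (1 / ((1 + Real.log (M / n)) ^ 2 * Real.log M ^ 2)) ≤
      C * divWeight n * (1 / ((1 + Real.log (M / n)) ^ 2 * Real.log M ^ 2)) := le_rfl
  have h2 : C * divWeight n * (1 / Real.log M ^ 3) ≤ C * divWeight n * ((1 + kappa n) / Real.log M ^ (2 + 1)) := by
    apply mul_le_mul_of_nonneg_left _ (by positivity)
    rw [div_le_div_iff_of_pos_right (by positivity)]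
    linarith
  linarith

/-- **Master input `t = τ_{1,0}`**: `R = −P′`, `s = 1`. [cite: KowalskiMichelVanderKam2000, (23)–(28) — derivation] -/
theorem masterInput_tau10 (P : ℝ[X]) (hP0 : P.coeff 0 = 0) (hP1 : P.coeff 1 = 0) :
    ∃ C : ℝ, 0 ≤ C ∧ ∀ M : ℝ, 3 ≤ M → ∀ n : ℕ, n ≠ 0 → (n : ℝ) ≤ M →
      |∑ c ∈ Finset.range (P.natDegree + 1), P.coeff c *
          ((∑ k ∈ Icc 1 ⌊M / n⌋₊, (if k.Coprime n then W k else 0) * (∑ d ∈ k.divisors, Real.log d) *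
            Real.log (M / n / k) ^ c) / Real.log M ^ c) -
        mainConst n * (-derivative P).eval (Real.log (M / n) / Real.log M) / Real.log M ^ 1| ≤
        C * divWeight n * ((1 + kappa n) / Real.log M ^ (1 + 1) +
          1 / ((1 + Real.log (M / n)) ^ 2 * Real.log M ^ 1)) := by
  obtain ⟨C, hC, h⟩ := abs_decorProfile_tau10_add_le P hP0 hP1
  refine ⟨C, hC.le, fun M hM n hn hnM ↦ ?_⟩
  have h' := h M hM n hn hnM
  have hℓ1 : 1 ≤ Real.log M := one_le_log_of_three_le hM
  have hℓ0 : 0 < Real.log M := by linarith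
  have hD := divWeight_nonneg n
  obtain ⟨hY0, -⟩ := log_div_nonneg_and_le hM hn hnM
  have e : ∑ c ∈ Finset.range (P.natDegree + 1), P.coeff c *
        ((∑ k ∈ Icc 1 ⌊M / n⌋₊, (if k.Coprime n then W k else 0) * (∑ d ∈ k.divisors, Real.log d) *
          Real.log (M / n / k) ^ c) / Real.log M ^ c) -
      mainConst n * (-derivative P).eval (Real.log (M / n) / Real.log M) / Real.log M ^ 1 =
      ∑ c ∈ Finset.range (P.natDegree + 1), P.coeff c *
        ((∑ k ∈ Icc 1 ⌊M / n⌋₊, (if k.Coprime n then W k else 0) * (∑ d ∈ k.divisors, Real.log d) *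
          Real.log (M / n / k) ^ c) / Real.log M ^ c) +
      mainConst n * (derivative P).eval (Real.log (M / n) / Real.log M) / Real.log M := by
    rw [Polynomial.eval_neg, pow_one]; ring
  rw [e]
  exact h'.trans (oneScale_le_twoScale (kappa n) hC.le hD hY0 hℓ0 1)

/-- **Master input `t = τ_{1,1}`**: `R = P`, `s = 0`. [cite: KowalskiMichelVanderKam2000, (23)–(28) — derivation] -/
theorem masterInput_tau11 (P : ℝ[X]) (hP0 : P.coeff 0 = 0) (hP1 : P.coeff 1 = 0) :
    ∃ C : ℝ, 0 ≤ C ∧ ∀ M : ℝ, 3 ≤ M → ∀ n : ℕ, n ≠ 0 → (n : ℝ) ≤ M →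
      |∑ c ∈ Finset.range (P.natDegree + 1), P.coeff c *
          ((∑ k ∈ Icc 1 ⌊M / n⌋₊, (if k.Coprime n then W k else 0) *
            (∑ d ∈ k.divisors, Real.log d * Real.log ((k / d : ℕ) : ℝ)) * Real.log (M / n / k) ^ c) / Real.log M ^ c) -
        mainConst n * P.eval (Real.log (M / n) / Real.log M) / Real.log M ^ 0| ≤
        C * divWeight n * ((1 + kappa n) / Real.log M ^ (0 + 1) +
          1 / ((1 + Real.log (M / n)) ^ 2 * Real.log M ^ 0)) := by
  obtain ⟨C, hC, h⟩ := abs_decorProfile_tau11_sub_le P hP0 hP1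
  refine ⟨C, hC.le, fun M hM n hn hnM ↦ ?_⟩
  have h' := h M hM n hn hnM
  have hℓ1 : 1 ≤ Real.log M := one_le_log_of_three_le hM
  have hℓ0 : 0 < Real.log M := by linarith
  have hD := divWeight_nonneg n
  obtain ⟨hY0, -⟩ := log_div_nonneg_and_le hM hn hnM
  rw [pow_zero, div_one, zero_add, pow_one, mul_one]
  refine h'.trans ?_
  have := oneScale_le_twoScale (kappa n) hC.le hD hY0 hℓ0 0
  rw [zero_add, pow_one, pow_zero, mul_one] at this
  exact this

/-- **Master input `t = τ_{2,0}`**: `R = 0`, `s = 0` (no main term). [cite: KowalskiMichelVanderKam2000, (23)–(28) — derivation] -/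
theorem masterInput_tau20 (P : ℝ[X]) (hP0 : P.coeff 0 = 0) (hP1 : P.coeff 1 = 0) :
    ∃ C : ℝ, 0 ≤ C ∧ ∀ M : ℝ, 3 ≤ M → ∀ n : ℕ, n ≠ 0 → (n : ℝ) ≤ M →
      |∑ c ∈ Finset.range (P.natDegree + 1), P.coeff c *
          ((∑ k ∈ Icc 1 ⌊M / n⌋₊, (if k.Coprime n then W k else 0) * (∑ d ∈ k.divisors, Real.log d ^ 2) *
            Real.log (M / n / k) ^ c) / Real.log M ^ c) -
        mainConst n * (0 : ℝ[X]).eval (Real.log (M / n) / Real.log M) / Real.log M ^ 0| ≤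
        C * divWeight n * ((1 + kappa n) / Real.log M ^ (0 + 1) +
          1 / ((1 + Real.log (M / n)) ^ 2 * Real.log M ^ 0)) := by
  obtain ⟨C, hC, h⟩ := abs_decorProfile_tau20_le P hP0 hP1
  refine ⟨C, hC.le, fun M hM n hn hnM ↦ ?_⟩
  have h' := h M hM n hn hnM
  have hℓ1 : 1 ≤ Real.log M := one_le_log_of_three_le hM
  have hℓ0 : 0 < Real.log M := by linarith
  have hD := divWeight_nonneg n
  obtain ⟨hY0, -⟩ := log_div_nonneg_and_le hM hn hnM
  rw [Polynomial.eval_zero, mul_zero, zero_div, sub_zero, zero_add, pow_one, pow_zero, mul_one]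
  refine h'.trans ?_
  have := oneScale_le_twoScale (kappa n) hC.le hD hY0 hℓ0 0
  rw [zero_add, pow_one, pow_zero, mul_one] at this
  exact this

/-! ### The first evaluated monomial of the order-(1,1) target -/

/-- **The `τ_{1,1}(k₁)τ_{1,1}(k₂)` monomial**: for `P₀ = P₁ = 0` there is `C` with, for all `M ≥ 3`,
`|Σ_{c≤⌊M⌋}Σ_{g≤⌊M⌋/c} μ(g)c·Σ_{k₁,k₂≤⌊M⌋/(cg)} y′(cgk₁)y′(cgk₂)·τ_{1,1}(k₁)τ_{1,1}(k₂) − (π²/6)²·(∫₀¹P²)·log M| ≤ C`.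
[cite: KowalskiMichelVanderKam2000, (23)–(28) and Prop. 5.1 — derivation (a degree-(2,2) monomial of the order-(1,1) diagonal term)] -/
theorem abs_selbergMonomial_tau11_tau11_sub_le (P : ℝ[X]) (hP0 : P.coeff 0 = 0) (hP1 : P.coeff 1 = 0) :
    ∃ C : ℝ, 0 < C ∧ ∀ M : ℝ, 3 ≤ M →
      |∑ c ∈ Icc 1 ⌊M⌋₊, ∑ g ∈ Icc 1 (⌊M⌋₊ / c), (μ g : ℝ) * c *
          ∑ k₁ ∈ Icc 1 (⌊M⌋₊ / (c * g)), ∑ k₂ ∈ Icc 1 (⌊M⌋₊ / (c * g)),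
            ((μ (c * g * k₁) : ℝ) * ((psi (c * g * k₁))⁻¹ *
                P.eval (Real.log (M / ((c * g * k₁ : ℕ) : ℝ)) / Real.log M))) / ((c * g * k₁ : ℕ) : ℝ) *
              (((μ (c * g * k₂) : ℝ) * ((psi (c * g * k₂))⁻¹ *
                P.eval (Real.log (M / ((c * g * k₂ : ℕ) : ℝ)) / Real.log M))) / ((c * g * k₂ : ℕ) : ℝ)) *
              ((∑ d ∈ k₁.divisors, Real.log d * Real.log ((k₁ / d : ℕ) : ℝ)) *
                (∑ d ∈ k₂.divisors, Real.log d * Real.log ((k₂ / d : ℕ) : ℝ))) -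
        (π ^ 2 / 6) ^ 2 * (∫ u in (0 : ℝ)..1, (P * P).eval u) * Real.log M| ≤ C := by
  obtain ⟨C₁, hC₁, h₁⟩ := masterInput_tau11 P hP0 hP1
  obtain ⟨C, hC, h⟩ := abs_selbergMonomial_two_scale_sub_le P
    (fun k ↦ ∑ d ∈ k.divisors, Real.log d * Real.log ((k / d : ℕ) : ℝ))
    (fun k ↦ ∑ d ∈ k.divisors, Real.log d * Real.log ((k / d : ℕ) : ℝ)) P P 0 0 hC₁ hC₁ h₁ h₁
  refine ⟨C, hC, fun M hM ↦ ?_⟩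
  have hℓ1 : 1 ≤ Real.log M := one_le_log_of_three_le hM
  have hℓ0 : Real.log M ≠ 0 := by linarith
  have h' := h M hM
  simp only [add_zero, pow_zero, div_one] at h'
  exact h'

end Summit.Parity.GeneralizedHardyLittlewood.Theorems.MomentsBeyondDiagonal.DiagKernel

end
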